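import Literature.InformationTheory.QuantumCodes.ClusterCountingBound
import Literature.InformationTheory.QuantumCodes.MinWeightDecodingClusters
import Literature.InformationTheory.QuantumCodes.CodeCapacityNoise
import HarnessLib

/-!
# Decoding the quantum erasure channel (one error type of a CSS / stabilizer code): correctable
# erasure patterns, erasure decoders, and the reduction "failure ⇒ the erasure covers a logical operator"

Topic `Literature/InformationTheory/QuantumCodes` (venture QEC, LADDER-QEC rungs Q4/Q5; qec-lit-2). The
vocabulary and the two elementary facts that every erasure-threshold argument in print starts from, PROVED
in the abstract additive picture of the tree's `SyndromeDecoding.lean` (errors of one type modulo phases =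
binary vectors `e : V → 𝔽₂` on the qubit set `V`, support `supp e`; a syndrome map `syn`, the set `N` of
undetectable errors, the set `S` of trivial errors / stabilizer elements):

* **The channel and the decoding task** (Delfosse–Zémor 2020 §2, "Maximum likelihood decoding for qubit
  loss"): "Each qubit is lost, or erased, independently with probability `p`. Such a loss can be detected and
  the missing qubit is then replaced by a totally mixed state … this new qubit can be interpreted as the
  original state which suffers from a Pauli error `I, X, Y` or `Z` chosen uniformly at random. The set of
  lost qubits is denoted by `ℰ`. The encoded state is subjected to a … Pauli error `P` whose support is
  included in `ℰ` … the goal of the decoder is to identify the coset `P·S` of the error, knowing the set `ℰ`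
  and the syndrome `σ` of `P`." So an ERASURE DECODER takes `(ℰ, σ)` (`ErasureDecoder`), and the erasure
  pattern `ℰ` is drawn from the independent (Bernoulli) law — the tree's `bernoulliWeight` / `eventProb` of
  `CodeCapacityNoise.lean` — or more generally from a locally stochastic law (`IsLocallyStochastic`).
* **Correctable erasure pattern** (`IsCorrectableErasure N S ℰ`): no non-trivial undetectable error (logical
  operator of this type) is supported inside `ℰ` — the one-type form of the tree's `IsCorrectableRegion`
  (`CorrectableRegions.lean`, stabilizer codes in symplectic form: "a region `M` is correctable iff there
  exists an error correction operation … that corrects the erasure of all particles in `M`",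
  Bravyi–Poulin–Terhal 2010) and of Stace–Barrett–Doherty's criterion ("if only a few physical qubits are
  lost, it is likely that each logical operator can be reliably measured by finding a homologically
  nontrivial cycle that avoids all lost qubits", 2009 p. 2). `|ℰ| ≤ d - 1` erasures are always correctable
  (`isCorrectableErasure_of_card_lt`: "to correct `r` such located errors, we need a code of distance at
  least `r+1`", Gottesman 1997 §2.3).
* **Reduction** (Delfosse–Zémor 2020 §2, the sentence proving their Lemma 1: "assume that we found an error
  `P̃ ⊂ ℰ` whose syndrome matches `σ`. Both errors `P` and `P̃` have the same syndrome, hence `P̃` and `P`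
  differ in a logical operator `L ⊂ ℰ`, trivial or not"): a decoder that answers every erasure-supported
  error by a syndrome-consistent correction supported inside the erasure (`IsConsistent`; their Lemma 1:
  every such answer "is a most likely coset", so this covers maximum-likelihood decoders and their
  linear-time peeling implementation, Thm. 1) corrects EVERY error supported in a correctable erasure
  (`IsConsistent.corrects`); conversely, on an uncorrectable erasure EVERY decoder fails on some error
  supported inside it (`exists_not_corrects_of_not_isCorrectableErasure`). Hence for consistent decoders the
  probability `failureProb` that the random erasure admits an error on which the decoder fails EQUALS the
  probability `uncorrectableProb` that the random erasure is uncorrectable (`failureProb_eq_uncorrectableProb`)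
  — the quantity bounded by counting in the threshold files (`y^{wgt U}` per covered logical operator:
  Dumer–Kovalev–Pryadko 2015 p. 4; `IsLocallyStochastic.sum_le_sum_pow_of_cover` is that union bound).
* Non-vacuity: the canonical consistent decoder (`canonical`, `canonical_isConsistent`).

Deliberately NOT here: the uniform conditional law of the Pauli error inside the erasure (only its support
matters for the statements above, which are uniform in the error), mixed erasure + Pauli channels
(Dumer–Kovalev–Pryadko's `Υ(y,p)`), the peeling algorithm itself, any numerical threshold (Stace et al.'s
`p_loss = 0.5` for the toric code is a percolation statement, not proved here).

## References

* [DelfosseZemor2020] N. Delfosse, G. Zémor, *Linear-time maximum likelihood decoding of surface codes over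
  the quantum erasure channel*, Phys. Rev. Research 2 (2020) 033042, arXiv:1703.01517 (held
  `paper:arxiv-1703.01517`): §2 "Maximum likelihood decoding for qubit loss" (chunk p0003 L1–41, Lemma 1
  L38–41), Algorithm 1 and Thm. 1 (p0004 L1–17).
* [StaceBarrettDoherty2009] T. M. Stace, S. D. Barrett, A. C. Doherty, *Thresholds for topological codes in
  the presence of loss*, PRL 102 (2009) 200501, arXiv:0904.3556 (held `paper:arxiv-0904.3556`): p. 2
  (loss model; logical operators avoiding the lost qubits; chunk p0002 L22–26, p0003 L1–3).
* [DumerKovalevPryadko2015] I. Dumer, A. A. Kovalev, L. P. Pryadko, PRL 115 (2015) 050502, arXiv:1412.6172: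
  p. 4 ("in the case of erasures with single-qubit probability `y`, a bad error must cover the entire support
  of `U`, which gives simply `y^{wgt(U)}`"; chunk p0004 L67–79).
* [Gottesman1997] D. Gottesman, *Stabilizer Codes and Quantum Error Correction*, Caltech thesis 1997,
  arXiv:quant-ph/9705052, §2.3 (located errors: distance `≥ r+1`; chunk p0014 L19–23).
* [BravyiPoulinTerhal2010] S. Bravyi, D. Poulin, B. Terhal, PRL 104 (2010) 050503, p. 2 (correctable
  regions) — via the tree's `CorrectableRegions.lean`.
-/

namespace Literature.InformationTheory.QuantumCodes

open Finset

variable {V : Type*} [Fintype V] [DecidableEq V] {Syn : Type*}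

/-! ### Correctable erasure patterns -/

/-- **Correctable erasure pattern** (one error type): every undetectable error (`∈ N`) supported inside
the erased set `Er` is trivial (`∈ S`) — no logical operator of this type "lives" inside `Er`
(Stace–Barrett–Doherty: recovery needs "a homologically nontrivial cycle that avoids all lost qubits";
Bravyi–Poulin–Terhal's correctable regions; Delfosse–Zémor: failure needs "a logical operator `L ⊂ ℰ`").
[cite: DelfosseZemor2020, §2 (logical operator L ⊂ ℰ, trivial or not)] -/
def IsCorrectableErasure (N S : Set (V → ZMod 2)) (Er : Finset V) : Prop :=
  ∀ x ∈ N, supp x ⊆ Er → x ∈ S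

omit [DecidableEq V] in
/-- Sub-patterns of a correctable erasure pattern are correctable. [cite: BravyiPoulinTerhal2010, p. 2 (correctable regions)] -/
theorem IsCorrectableErasure.anti {N S : Set (V → ZMod 2)} {Er Er' : Finset V}
    (h : IsCorrectableErasure N S Er) (hsub : Er' ⊆ Er) : IsCorrectableErasure N S Er' :=
  fun x hx hxE => h x hx (hxE.trans hsub)

omit [DecidableEq V] in
/-- **`d - 1` erasures are correctable**: if every non-trivial undetectable error has weight `≥ d`, every
erasure pattern of fewer than `d` qubits is correctable ("to correct `r` such located errors, we need a code
of distance at least `r+1`"). [cite: Gottesman1997, §2.3 (located errors: distance at least r+1)] -/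
theorem isCorrectableErasure_of_card_lt {N S : Set (V → ZMod 2)} {d : ℕ}
    (hd : ∀ x ∈ N, x ∉ S → d ≤ hammingNorm x) {Er : Finset V} (hEr : Er.card < d) :
    IsCorrectableErasure N S Er := by
  intro x hx hxE
  by_contra hxS
  have h1 := hd x hx hxS
  have h2 : (supp x).card ≤ Er.card := card_le_card hxE
  have h3 : hammingNorm x = (supp x).card := rfl
  omega

/-! ### Erasure decoders -/

/-- An **erasure decoder** for one error type: (erasure pattern, syndrome) ↦ correction — "the goal of the
decoder is to identify the coset `P·S` of the error, knowing the set `ℰ` and the syndrome `σ` of `P`".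
(definition) [cite: DelfosseZemor2020, §2 (decoder knowing ℰ and σ)] -/
abbrev ErasureDecoder (V : Type*) (Syn : Type*) : Type _ := Finset V → Syn → (V → ZMod 2)

namespace ErasureDecoder

/-- `D` **corrects** the error `e` given the erasure pattern `Er`: the net operation `D (Er, syn e) + e` is
trivial (acts as the identity on the code space; degenerate corrections count as successes, as in the tree's
`Decoder.Corrects`). (definition) [cite: DelfosseZemor2020, §2 (identify the coset P·S)] -/
def Corrects (D : ErasureDecoder V Syn) (syn : (V → ZMod 2) → Syn) (S : Set (V → ZMod 2))
    (Er : Finset V) (e : V → ZMod 2) : Prop :=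
  D Er (syn e) + e ∈ S

/-- A **consistent** erasure decoder: on every error supported inside the erasure it returns a correction
that is syndrome-consistent (the net error is undetectable) and is itself supported inside the erasure —
"an error `P̃ ⊂ ℰ` whose syndrome matches `σ`"; by Delfosse–Zémor's Lemma 1 every such answer is a most
likely coset, so maximum-likelihood erasure decoders (and the linear-time peeling decoder, Thm. 1) are
consistent. (definition) [cite: DelfosseZemor2020, Lemma 1] -/
structure IsConsistent (D : ErasureDecoder V Syn) (syn : (V → ZMod 2) → Syn) (N : Set (V → ZMod 2)) :
    Prop where
  /-- the correction has the syndrome of the error: the net error is undetectable -/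
  add_mem : ∀ (Er : Finset V) (e : V → ZMod 2), supp e ⊆ Er → D Er (syn e) + e ∈ N
  /-- the correction is supported inside the erasure -/
  supp_subset : ∀ (Er : Finset V) (e : V → ZMod 2), supp e ⊆ Er → supp (D Er (syn e)) ⊆ Er

omit [DecidableEq V] in
/-- Membership in the support. [folklore] -/
private theorem mem_supp_iff {x : V → ZMod 2} {v : V} : v ∈ supp x ↔ x v ≠ 0 := by
  simp [supp]

/-- The support of a sum lies in the union of the supports. [folklore] -/
private theorem supp_add_subset (a b : V → ZMod 2) : supp (a + b) ⊆ supp a ∪ supp b := by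
  intro v hv
  rw [mem_union, mem_supp_iff, mem_supp_iff]
  rw [mem_supp_iff, Pi.add_apply] at hv
  by_contra h
  push Not at h
  rw [h.1, h.2, add_zero] at hv
  exact hv rfl

/-- **Reduction (Delfosse–Zémor).** A consistent decoder corrects every error supported inside a
correctable erasure pattern: the net error `D(ℰ, σ) + e` is undetectable and supported in `ℰ` ("`P̃` and
`P` differ in a logical operator `L ⊂ ℰ`"), hence trivial. [cite: DelfosseZemor2020, §2 (proof of Lemma 1)] -/
theorem IsConsistent.corrects {D : ErasureDecoder V Syn} {syn : (V → ZMod 2) → Syn}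
    {N S : Set (V → ZMod 2)} (hD : D.IsConsistent syn N) {Er : Finset V} {e : V → ZMod 2}
    (hEr : IsCorrectableErasure N S Er) (he : supp e ⊆ Er) : D.Corrects syn S Er e :=
  hEr _ (hD.add_mem Er e he) ((supp_add_subset _ _).trans (union_subset (hD.supp_subset Er e he) he))

omit [DecidableEq V] in
/-- **Converse: uncorrectable erasures defeat every decoder.** If a non-trivial undetectable `x` is
supported inside `Er` then any (deterministic) erasure decoder fails on `0` or on `x` — both supported in
`Er` and with the same syndrome (`S` a subspace, undetectable errors share the syndrome of `0`).
[cite: DelfosseZemor2020, §2 (all the cosets are equiprobable)] -/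
theorem exists_not_corrects_of_not_isCorrectableErasure (D : ErasureDecoder V Syn)
    {syn : (V → ZMod 2) → Syn} {N : Set (V → ZMod 2)} (S : Submodule (ZMod 2) (V → ZMod 2))
    (hN : ∀ x ∈ N, syn x = syn 0) {Er : Finset V} (hEr : ¬ IsCorrectableErasure N S Er) :
    ∃ e : V → ZMod 2, supp e ⊆ Er ∧ ¬ D.Corrects syn S Er e := by
  unfold IsCorrectableErasure at hEr
  push Not at hEr
  obtain ⟨x, hxN, hxE, hxS⟩ := hEr
  by_contra h
  push Not at h
  have h0 := h 0 (by
    intro v hv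
    rw [mem_supp_iff] at hv
    exact (hv rfl).elim)
  have hx := h x hxE
  unfold Corrects at h0 hx
  rw [add_zero] at h0
  rw [hN x hxN] at hx
  apply hxS
  have h1 := S.sub_mem hx h0
  rwa [add_sub_cancel_left] at h1

/-- For a subspace `S` of trivial errors and undetectable errors sharing the syndrome of `0`: an erasure
pattern is correctable iff some (equivalently every) consistent decoder corrects every error supported in
it. [cite: DelfosseZemor2020, Lemma 1] -/
theorem isCorrectableErasure_iff_forall_corrects {D : ErasureDecoder V Syn} {syn : (V → ZMod 2) → Syn}
    {N : Set (V → ZMod 2)} (S : Submodule (ZMod 2) (V → ZMod 2)) (hD : D.IsConsistent syn N)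
    (hN : ∀ x ∈ N, syn x = syn 0) (Er : Finset V) :
    IsCorrectableErasure N S Er ↔ ∀ e : V → ZMod 2, supp e ⊆ Er → D.Corrects syn S Er e := by
  constructor
  · intro h e he
    exact hD.corrects h he
  · intro h
    by_contra hEr
    obtain ⟨e, he, hfail⟩ := exists_not_corrects_of_not_isCorrectableErasure D S hN hEr
    exact hfail (h e he)

open Classical in
/-- **The canonical erasure decoder**: answer `(Er, s)` by some error supported in `Er` with syndrome `s`
if there is one (any choice; "returning an error … `P̃ ⊂ ℰ` … [whose] syndrome … is equal to a given `σ`"),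
and by `0` otherwise. (definition, noncomputable choice; the peeling decoder is a linear-time realisation
for surface codes.) [cite: DelfosseZemor2020, Lemma 1] -/
noncomputable def canonical (syn : (V → ZMod 2) → Syn) : ErasureDecoder V Syn := fun Er s =>
  if h : ∃ e : V → ZMod 2, supp e ⊆ Er ∧ syn e = s then Classical.choose h else 0

/-- The canonical erasure decoder is consistent whenever errors with equal syndromes differ by an
undetectable error (non-vacuity of `IsConsistent`). [cite: DelfosseZemor2020, Lemma 1] -/
theorem canonical_isConsistent (syn : (V → ZMod 2) → Syn) (N : Set (V → ZMod 2))
    (hN : ∀ e e' : V → ZMod 2, syn e' = syn e → e' + e ∈ N) : (canonical syn).IsConsistent syn N := by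
  classical
  constructor
  · intro Er e he
    have h : ∃ e' : V → ZMod 2, supp e' ⊆ Er ∧ syn e' = syn e := ⟨e, he, rfl⟩
    have hc : canonical syn Er (syn e) = Classical.choose h := by
      unfold canonical
      rw [dif_pos h]
    rw [hc]
    exact hN e _ (Classical.choose_spec h).2
  · intro Er e he
    have h : ∃ e' : V → ZMod 2, supp e' ⊆ Er ∧ syn e' = syn e := ⟨e, he, rfl⟩
    have hc : canonical syn Er (syn e) = Classical.choose h := by
      unfold canonical
      rw [dif_pos h]
    rw [hc]
    exact (Classical.choose_spec h).1

/-! ### Failure probabilities under random erasures -/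

open Classical in
/-- **Probability that the erasure pattern is uncorrectable** under independent erasures of rate `p`
(each qubit "lost, or erased, independently with probability `p`"): `Σ_{Er uncorrectable} p^{|Er|}
(1-p)^{|V|-|Er|}`. [cite: DelfosseZemor2020, §2 (each qubit erased independently with probability p)] -/
noncomputable def uncorrectableProb (N S : Set (V → ZMod 2)) (p : ℝ) : ℝ :=
  eventProb (fun Er : Finset V => ¬ IsCorrectableErasure N S Er) p

open Classical in
/-- **Failure probability of an erasure decoder** under independent erasures of rate `p`, in the robust
form that is uniform in the (uniformly random, or arbitrary) Pauli error inside the erasure: the probability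
that the erasure pattern admits SOME error supported inside it which `D` does not correct. (For a consistent
decoder this equals `uncorrectableProb`, `failureProb_eq_uncorrectableProb`; it dominates the failure
probability under any law of the error supported in the erasure.)
[cite: DelfosseZemor2020, §2 (random Pauli error with support included in ℰ)] -/
noncomputable def failureProb (D : ErasureDecoder V Syn) (syn : (V → ZMod 2) → Syn)
    (S : Set (V → ZMod 2)) (p : ℝ) : ℝ :=
  eventProb (fun Er : Finset V => ∃ e : V → ZMod 2, supp e ⊆ Er ∧ ¬ D.Corrects syn S Er e) p

omit [DecidableEq V] in
/-- `uncorrectableProb` as the sum over the uncorrectable erasure patterns (any decidability instance).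
[cite: DelfosseZemor2020, §2 (erasure law)] -/
theorem uncorrectableProb_eq_sum (N S : Set (V → ZMod 2)) (p : ℝ)
    [DecidablePred fun Er : Finset V => ¬ IsCorrectableErasure N S Er] :
    uncorrectableProb N S p =
      ∑ Er ∈ univ.filter (fun Er : Finset V => ¬ IsCorrectableErasure N S Er), bernoulliWeight p Er := by
  unfold uncorrectableProb eventProb
  congr 1
  ext Er
  simp only [mem_filter, mem_univ, true_and]

omit [DecidableEq V] in
/-- The probabilities are non-negative. [cite: DelfosseZemor2020, §2 (erasure law)] -/
theorem uncorrectableProb_nonneg (N S : Set (V → ZMod 2)) {p : ℝ} (hp0 : 0 ≤ p) (hp1 : p ≤ 1) :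
    0 ≤ uncorrectableProb N S p := by
  classical
  unfold uncorrectableProb
  exact eventProb_nonneg _ hp0 hp1

/-- The probabilities are non-negative. [cite: DelfosseZemor2020, §2 (erasure law)] -/
theorem failureProb_nonneg (D : ErasureDecoder V Syn) (syn : (V → ZMod 2) → Syn) (S : Set (V → ZMod 2))
    {p : ℝ} (hp0 : 0 ≤ p) (hp1 : p ≤ 1) : 0 ≤ D.failureProb syn S p := by
  classical
  unfold failureProb
  exact eventProb_nonneg _ hp0 hp1

/-- **A consistent decoder fails only on uncorrectable erasures**: `failureProb ≤ uncorrectableProb`.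
[cite: DelfosseZemor2020, Lemma 1] -/
theorem failureProb_le_uncorrectableProb {D : ErasureDecoder V Syn} {syn : (V → ZMod 2) → Syn}
    {N : Set (V → ZMod 2)} (hD : D.IsConsistent syn N) (S : Set (V → ZMod 2)) {p : ℝ} (hp0 : 0 ≤ p)
    (hp1 : p ≤ 1) : D.failureProb syn S p ≤ uncorrectableProb N S p := by
  classical
  unfold failureProb uncorrectableProb
  refine eventProb_mono (fun Er h => ?_) hp0 hp1
  obtain ⟨e, he, hfail⟩ := h
  exact fun hEr => hfail (hD.corrects hEr he)

/-- **Every decoder fails on uncorrectable erasures**: `uncorrectableProb ≤ failureProb` (subspace of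
trivial errors; undetectable errors share the syndrome of `0`). [cite: DelfosseZemor2020, §2 (all the cosets are equiprobable)] -/
theorem uncorrectableProb_le_failureProb (D : ErasureDecoder V Syn) {syn : (V → ZMod 2) → Syn}
    {N : Set (V → ZMod 2)} (S : Submodule (ZMod 2) (V → ZMod 2)) (hN : ∀ x ∈ N, syn x = syn 0) {p : ℝ}
    (hp0 : 0 ≤ p) (hp1 : p ≤ 1) : uncorrectableProb N S p ≤ D.failureProb syn S p := by
  classical
  unfold failureProb uncorrectableProb
  exact eventProb_mono (fun Er h => exists_not_corrects_of_not_isCorrectableErasure D S hN h) hp0 hp1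

/-- For consistent decoders the two probabilities coincide: the erasure threshold of (maximum-likelihood /
peeling / any consistent) erasure decoding IS the threshold for correctability of the random erasure
pattern. [cite: DelfosseZemor2020, Lemma 1] -/
theorem failureProb_eq_uncorrectableProb {D : ErasureDecoder V Syn} {syn : (V → ZMod 2) → Syn}
    {N : Set (V → ZMod 2)} (S : Submodule (ZMod 2) (V → ZMod 2)) (hD : D.IsConsistent syn N)
    (hN : ∀ x ∈ N, syn x = syn 0) {p : ℝ} (hp0 : 0 ≤ p) (hp1 : p ≤ 1) :
    D.failureProb syn S p = uncorrectableProb N S p :=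
  le_antisymm (failureProb_le_uncorrectableProb hD S hp0 hp1) (uncorrectableProb_le_failureProb D S hN hp0 hp1)

end ErasureDecoder

/-! ### The union bound over covering sets -/

/-- **Union bound for covering events under a locally stochastic law.** If every pattern `E ∈ Bad`
contains some member `T a`, `a ∈ Ps`, of a finite family of sets, then `Σ_{E ∈ Bad} μ E ≤ Σ_{a ∈ Ps}
p^{|T a|}` — "a bad error must cover the entire support of `U`, which gives simply `y^{wgt(U)}`", summed
over the family. [cite: DumerKovalevPryadko2015, p. 4 (Prob[E ∈ B(U)] = y^{wgt U}, summed over U)] -/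
theorem IsLocallyStochastic.sum_le_sum_pow_of_cover {μ : Finset V → ℝ} {p : ℝ}
    (hμ : IsLocallyStochastic μ p) {α : Type*} (Ps : Finset α) (T : α → Finset V)
    (Bad : Finset (Finset V)) (hcover : ∀ E ∈ Bad, ∃ a ∈ Ps, T a ⊆ E) :
    ∑ E ∈ Bad, μ E ≤ ∑ a ∈ Ps, p ^ (T a).card := by
  classical
  have hnn : ∀ E : Finset V, 0 ≤ μ E := hμ.nonneg
  calc ∑ E ∈ Bad, μ E
      ≤ ∑ E ∈ Bad, ∑ a ∈ Ps, (if T a ⊆ E then μ E else 0) := by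
        refine Finset.sum_le_sum fun E hE => ?_
        obtain ⟨a, ha, haE⟩ := hcover E hE
        calc μ E = (if T a ⊆ E then μ E else 0) := by rw [if_pos haE]
          _ ≤ ∑ a ∈ Ps, (if T a ⊆ E then μ E else 0) :=
              Finset.single_le_sum (f := fun a => if T a ⊆ E then μ E else 0)
                (fun b _ => by split_ifs <;> simp [hnn E]) ha
    _ = ∑ a ∈ Ps, ∑ E ∈ Bad, (if T a ⊆ E then μ E else 0) := Finset.sum_comm
    _ ≤ ∑ a ∈ Ps, ∑ E, (if T a ⊆ E then μ E else 0) := by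
        refine Finset.sum_le_sum fun a _ => ?_
        exact Finset.sum_le_sum_of_subset_of_nonneg (Finset.subset_univ _)
          (fun E _ _ => by split_ifs <;> simp [hnn E])
    _ = ∑ a ∈ Ps, ∑ E ∈ univ.filter (fun E => T a ⊆ E), μ E := by
        refine Finset.sum_congr rfl fun a _ => ?_
        rw [Finset.sum_filter]
    _ ≤ ∑ a ∈ Ps, p ^ (T a).card :=
        Finset.sum_le_sum fun a _ => hμ.sum_filter_superset_le (T a)

end Literature.InformationTheory.QuantumCodes
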